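import Literature.NumberTheory.LFunctions.WeilTwoPrimeQuadratic
import HarnessLib

/-!
# The analytic form of Weil's quadratic functional on every finite-prime cone `C((log (N+1))/2)`

For a test function `g` with `tsupport g ⊆ [-(log (N+1))/2, (log (N+1))/2]` the kernel `k = g ⋆ g̃` is supported
in `[-log (N+1), log (N+1)]`, so only the prime powers `n ≤ N` enter the explicit formula (`k(± log n) = 0` for
`n ≥ N + 1` because the support of `k` is open inside the closed window).  By Mellin (Fourier) inversion on the
critical line, `2π (k(x) + k(−x)) = ∫ |ĝ(1/2+it)|² 2cos(tx) dt` (`weilConv_weilReflect_add_at`, in the tree), so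
EVERY prime power is diagonal in frequency and Weil's quadratic functional takes Yoshida's analytic shape with
the finitely rippled weight

`Re Q(g) = E_N(g) := 2 Re(ĝ(0) conj ĝ(1)) − (log π)‖g‖₂² + (1/2π) ∫ |ĝ(1/2+it)|² w_N(t) dt`,
`w_N(t) = Re ψ(1/4 + it/2) − Σ_{n ≤ N} (Λ(n)/√n) · 2cos(t log n)`

(`weilPrimeRipple`, `weilFinitePrimeWeight`, `weilFinitePrimeQuadratic`, `weilQuadratic_eq_weilFinitePrimeQuadratic`).
The cases `N = 3` (the two-prime form `E₂₃` of `WeilTwoPrimeQuadratic`, window `log 2`) and `N = 4` (the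
`{2,3,4}`-form `E₂₃₄`, window `(log 5)/2`, prime powers `2, 3, 4 = 2²` with `Λ(4)/√4 = (log 2)/2`) are spelled out:
`weilFinitePrimeQuadratic_three`, `weilThreePrimeWeight`, `weilThreePrimeQuadratic`,
`weilQuadratic_re_eq_weilThreePrimeQuadratic` — the analytic form every certificate on the `{2,3,4}`-window
`(log 2, (log 5)/2]` of the parity ladders reduces to.  Everything here is proved; there are no named facts.

## References

* H. Yoshida, *On Hermitian forms attached to zeta functions*, Adv. Stud. Pure Math. 21 (1992), §2 eq. (2.1)
  (the analytic form with the finitely many `p^m`-terms visible on the support).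
* E. Bombieri, *Remarks on Weil's quadratic functional in the theory of prime numbers I*, Rend. Mat. Acc. Lincei
  (9) 11 (2000), Thm 2 (explicit formula), §2 (Mellin inversion).
* A. Connes, C. Consani, *Spectral triples and ζ-cycles*, arXiv:2106.01715, §2.3 (the semi-local Weil quadratic
  form with finitely many primes).
-/

noncomputable section

open Complex Filter Set MeasureTheory
open scoped Real Topology ComplexConjugate

namespace Literature.NumberTheory.LFunctions

variable {g : ℝ → ℂ}

/-! ## The finitely rippled weight and the analytic form -/

/-- The truncated prime ripple `ρ_N(t) = Σ_{n ≤ N} (Λ(n)/√n) · 2cos(t log n)`: the frequency-side image of the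
prime spikes `(Λ(n)/√n)(δ_{log n} + δ_{−log n})`, `n ≤ N`. [cite: Yoshida1992, §2 eq. (2.1), the p^m-terms with p^m ≤ N] -/
def weilPrimeRipple (N : ℕ) (t : ℝ) : ℝ :=
  ∑ n ∈ Finset.range (N + 1),
    (ArithmeticFunction.vonMangoldt n : ℝ) / Real.sqrt n * (2 * Real.cos (t * Real.log n))

/-- The finite-prime Weil weight `w_N(t) = Re ψ(1/4 + it/2) − ρ_N(t)`. [cite: Yoshida1992, §2 eq. (2.1), the p^m-terms with p^m ≤ N] -/
def weilFinitePrimeWeight (N : ℕ) (t : ℝ) : ℝ :=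
  Literature.Analysis.SpecialFunctions.reDigammaQuarter t - weilPrimeRipple N t

/-- The finite-prime analytic form
`E_N(g) = 2 Re(ĝ(0) conj ĝ(1)) − (log π) ‖g‖₂² + (1/2π) ∫ |ĝ(1/2+it)|² w_N(t) dt`. [cite: Yoshida1992, §2 eq. (2.1), the p^m-terms with p^m ≤ N] -/
def weilFinitePrimeQuadratic (N : ℕ) (g : ℝ → ℂ) : ℝ :=
  2 * (weilMellin g 0 * conj (weilMellin g 1)).re - Real.log π * weilNorm2Sq g +
    1 / (2 * π) * ∫ t : ℝ, ‖weilMellin g (1 / 2 + t * I)‖ ^ 2 * weilFinitePrimeWeight N t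

/-- The ripple is continuous in `t`. [folklore] -/
theorem continuous_weilPrimeRipple (N : ℕ) : Continuous (weilPrimeRipple N) := by
  unfold weilPrimeRipple
  fun_prop

/-- The weight is measurable. [folklore] -/
theorem measurable_weilFinitePrimeWeight (N : ℕ) : Measurable (weilFinitePrimeWeight N) :=
  Literature.Analysis.SpecialFunctions.measurable_reDigammaQuarter.sub
    (continuous_weilPrimeRipple N).measurable

/-- `t ↦ |ĝ(1/2+it)|² · 2cos(t x)` is integrable. [folklore] -/
theorem integrable_norm_sq_weilMellin_mul_two_cos (hg : IsWeilTest g) (x : ℝ) :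
    Integrable fun t : ℝ ↦ ‖weilMellin g (1 / 2 + t * I)‖ ^ 2 * (2 * Real.cos (t * x)) :=
  integrable_norm_sq_weilMellin_mul_const_mul_cos hg 2 x

/-- `t ↦ |ĝ(1/2+it)|² ρ_N(t)` is integrable, and its integral is the finite sum of the spike integrals:
`∫ |ĝ|² ρ_N = Σ_{n ≤ N} (Λ(n)/√n) ∫ |ĝ(1/2+it)|² 2cos(t log n) dt`. [folklore] -/
theorem integral_norm_sq_weilMellin_mul_weilPrimeRipple (hg : IsWeilTest g) (N : ℕ) :
    Integrable (fun t : ℝ ↦ ‖weilMellin g (1 / 2 + t * I)‖ ^ 2 * weilPrimeRipple N t) ∧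
      ∫ t : ℝ, ‖weilMellin g (1 / 2 + t * I)‖ ^ 2 * weilPrimeRipple N t =
        ∑ n ∈ Finset.range (N + 1), (ArithmeticFunction.vonMangoldt n : ℝ) / Real.sqrt n *
          ∫ t : ℝ, ‖weilMellin g (1 / 2 + t * I)‖ ^ 2 * (2 * Real.cos (t * Real.log n)) := by
  have e : (fun t : ℝ ↦ ‖weilMellin g (1 / 2 + t * I)‖ ^ 2 * weilPrimeRipple N t) =
      fun t : ℝ ↦ ∑ n ∈ Finset.range (N + 1), (ArithmeticFunction.vonMangoldt n : ℝ) / Real.sqrt n *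
        (‖weilMellin g (1 / 2 + t * I)‖ ^ 2 * (2 * Real.cos (t * Real.log n))) := by
    funext t
    unfold weilPrimeRipple
    rw [Finset.mul_sum]
    exact Finset.sum_congr rfl fun n _ ↦ by ring
  have hI : ∀ n ∈ Finset.range (N + 1), Integrable fun t : ℝ ↦
      (ArithmeticFunction.vonMangoldt n : ℝ) / Real.sqrt n *
        (‖weilMellin g (1 / 2 + t * I)‖ ^ 2 * (2 * Real.cos (t * Real.log n))) :=
    fun n _ ↦ (integrable_norm_sq_weilMellin_mul_two_cos hg (Real.log n)).const_mul _
  rw [e]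
  refine ⟨integrable_finsetSum _ hI, ?_⟩
  rw [integral_finsetSum _ hI]
  exact Finset.sum_congr rfl fun n _ ↦ integral_const_mul _ _

/-- `t ↦ |ĝ(1/2+it)|² w_N(t)` is integrable. [folklore] -/
theorem integrable_norm_sq_weilMellin_mul_weilFinitePrimeWeight (hg : IsWeilTest g) (N : ℕ) :
    Integrable fun t : ℝ ↦ ‖weilMellin g (1 / 2 + t * I)‖ ^ 2 * weilFinitePrimeWeight N t := by
  have h1 := integrable_norm_sq_weilMellin_mul_reDigammaQuarter hg
  have h2 := (integral_norm_sq_weilMellin_mul_weilPrimeRipple hg N).1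
  have e : (fun t : ℝ ↦ ‖weilMellin g (1 / 2 + t * I)‖ ^ 2 * weilFinitePrimeWeight N t) =
      fun t : ℝ ↦ ‖weilMellin g (1 / 2 + t * I)‖ ^ 2 *
          Literature.Analysis.SpecialFunctions.reDigammaQuarter t -
        ‖weilMellin g (1 / 2 + t * I)‖ ^ 2 * weilPrimeRipple N t := by
    funext t; unfold weilFinitePrimeWeight; ring
  rw [e]
  exact h1.sub h2

/-! ## Only the prime powers `n ≤ N` enter on the window `[-log (N+1), log (N+1)]` -/

/-- For a continuous `k` with `tsupport k ⊆ [-log (N+1), log (N+1)]` the prime term of `W` is the FINITE sum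
`Σ_{n ≤ N} (Λ(n)/√n)(k(log n) + k(−log n))`: `k(±log n) = 0` for `n ≥ N + 1` because the support is open inside
the closed window. [cite: Bombieri2000Weil, Thm 2 (prime side) restricted to supp ⊆ [−log (N+1), log (N+1)]] -/
theorem weilPrimeTerm_eq_sum_of_tsupport_subset {k : ℝ → ℂ} (hk : Continuous k) (N : ℕ)
    (hsupp : tsupport k ⊆ Icc (-Real.log ((N : ℝ) + 1)) (Real.log ((N : ℝ) + 1))) :
    weilPrimeTerm k =
      ∑ n ∈ Finset.range (N + 1), ((ArithmeticFunction.vonMangoldt n : ℝ) : ℂ) / (Real.sqrt n : ℂ) *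
        (k (Real.log n) + k (-Real.log n)) := by
  have hIoo : Function.support k ⊆ Ioo (-Real.log ((N : ℝ) + 1)) (Real.log ((N : ℝ) + 1)) :=
    support_subset_Ioo_of_tsupport_subset_Icc hk hsupp
  have hzero : ∀ x : ℝ, Real.log ((N : ℝ) + 1) ≤ |x| → k x = 0 := by
    intro x hx
    by_contra hne
    have hmem := hIoo (Function.mem_support.2 hne)
    rw [mem_Ioo] at hmem
    have : |x| < Real.log ((N : ℝ) + 1) := abs_lt.2 ⟨hmem.1, hmem.2⟩
    linarith
  have hfin : ∀ n ∉ Finset.range (N + 1),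
      ((ArithmeticFunction.vonMangoldt n : ℝ) : ℂ) / (Real.sqrt n : ℂ) *
        (k (Real.log n) + k (-Real.log n)) = 0 := by
    intro n hn
    rw [Finset.mem_range, not_lt] at hn
    have hn' : (N : ℝ) + 1 ≤ n := by exact_mod_cast hn
    have hlog : Real.log ((N : ℝ) + 1) ≤ Real.log n := Real.log_le_log (by positivity) hn'
    have hpos : 0 ≤ Real.log n := (Real.log_nonneg (by linarith)).trans hlog
    rw [hzero _ (by rwa [abs_of_nonneg hpos]), hzero _ (by rwa [abs_neg, abs_of_nonneg hpos])]
    simp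
  unfold weilPrimeTerm
  exact tsum_eq_sum hfin

/-! ## The analytic form on the finite-prime cone -/

/-- **`Q(g)` in analytic form on `C((log (N+1))/2)`.** For `tsupport g ⊆ [-(log (N+1))/2, (log (N+1))/2]`,
`W(g ⋆ g̃) = E_N(g)` as a complex number: polar term `2 Re(ĝ(0) conj ĝ(1))`, prime terms
`Σ_{n ≤ N} (Λ(n)/√n)·(1/2π)∫|ĝ|² 2cos(t log n)`, archimedean term `(1/2π)∫|ĝ|² Re ψ(1/4+it/2) − (log π)‖g‖₂²`.
[cite: Yoshida1992, §2 eq. (2.1), the p^m-terms with p^m ≤ N; ConnesConsani2023 §2.3] -/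
theorem weilQuadratic_eq_weilFinitePrimeQuadratic (hg : IsWeilTest g) (N : ℕ)
    (hsupp : tsupport g ⊆ Icc (-(Real.log ((N : ℝ) + 1) / 2)) (Real.log ((N : ℝ) + 1) / 2)) :
    weilQuadratic g = (weilFinitePrimeQuadratic N g : ℂ) := by
  have hk : IsWeilTest (weilConv g (weilReflect g)) := hg.weilConv hg.weilReflect
  have hks : tsupport (weilConv g (weilReflect g)) ⊆
      Icc (-Real.log ((N : ℝ) + 1)) (Real.log ((N : ℝ) + 1)) := by
    have h := tsupport_weilConv_weilReflect_subset (a := Real.log ((N : ℝ) + 1) / 2) hg.2 hsupp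
    rwa [show 2 * (Real.log ((N : ℝ) + 1) / 2) = Real.log ((N : ℝ) + 1) by ring] at h
  -- the spikes as frequency integrals
  set S : ℂ := ∑ n ∈ Finset.range (N + 1),
      ((ArithmeticFunction.vonMangoldt n : ℝ) : ℂ) / (Real.sqrt n : ℂ) *
        ((∫ t : ℝ, ‖weilMellin g (1 / 2 + t * I)‖ ^ 2 * (2 * Real.cos (t * Real.log n)) : ℝ) : ℂ)
    with hS
  have hprime : weilPrimeTerm (weilConv g (weilReflect g)) = (1 / (2 * π) : ℂ) * S := by
    rw [weilPrimeTerm_eq_sum_of_tsupport_subset hk.1.continuous N hks, hS, Finset.mul_sum]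
    refine Finset.sum_congr rfl fun n _ ↦ ?_
    rw [weilConv_weilReflect_add_eq_integral hg (Real.log n)]
    ring
  -- the rippled part of the weight integral is the same finite sum
  have hrip : (((∫ t : ℝ, ‖weilMellin g (1 / 2 + t * I)‖ ^ 2 * weilPrimeRipple N t) : ℝ) : ℂ) = S := by
    rw [(integral_norm_sq_weilMellin_mul_weilPrimeRipple hg N).2, hS]
    push_cast
    rfl
  have hsplit : ∫ t : ℝ, ‖weilMellin g (1 / 2 + t * I)‖ ^ 2 * weilFinitePrimeWeight N t =
      (∫ t : ℝ, ‖weilMellin g (1 / 2 + t * I)‖ ^ 2 *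
          Literature.Analysis.SpecialFunctions.reDigammaQuarter t) -
        ∫ t : ℝ, ‖weilMellin g (1 / 2 + t * I)‖ ^ 2 * weilPrimeRipple N t := by
    have e : (fun t : ℝ ↦ ‖weilMellin g (1 / 2 + t * I)‖ ^ 2 * weilFinitePrimeWeight N t) =
        fun t : ℝ ↦ ‖weilMellin g (1 / 2 + t * I)‖ ^ 2 *
            Literature.Analysis.SpecialFunctions.reDigammaQuarter t -
          ‖weilMellin g (1 / 2 + t * I)‖ ^ 2 * weilPrimeRipple N t := by
      funext t; unfold weilFinitePrimeWeight; ring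
    rw [e, integral_sub (integrable_norm_sq_weilMellin_mul_reDigammaQuarter hg)
      (integral_norm_sq_weilMellin_mul_weilPrimeRipple hg N).1]
  unfold weilQuadratic weilFunctional weilArchTerm weilFinitePrimeQuadratic
  rw [hprime, weilPolarTerm_weilConv_weilReflect hg, weilArchIntegral_weilConv_weilReflect hg,
    weilConv_weilReflect_apply_zero, hsplit]
  unfold weilNorm2Sq Literature.Analysis.SpecialFunctions.reDigammaQuarter
  push_cast
  rw [hrip]
  ring

/-- Real-part version: `Re Q(g) = E_N(g)` on `C((log (N+1))/2)`. [cite: Yoshida1992, §2 eq. (2.1), the p^m-terms with p^m ≤ N] -/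
theorem weilQuadratic_re_eq_weilFinitePrimeQuadratic (hg : IsWeilTest g) (N : ℕ)
    (hsupp : tsupport g ⊆ Icc (-(Real.log ((N : ℝ) + 1) / 2)) (Real.log ((N : ℝ) + 1) / 2)) :
    (weilQuadratic g).re = weilFinitePrimeQuadratic N g := by
  rw [weilQuadratic_eq_weilFinitePrimeQuadratic hg N hsupp, Complex.ofReal_re]

/-- On `C((log (N+1))/2)` the quadratic functional is real: `Im Q(g) = 0`. [folklore] -/
theorem weilQuadratic_im_eq_zero_of_tsupport_subset_log_succ_half (hg : IsWeilTest g) (N : ℕ)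
    (hsupp : tsupport g ⊆ Icc (-(Real.log ((N : ℝ) + 1) / 2)) (Real.log ((N : ℝ) + 1) / 2)) :
    (weilQuadratic g).im = 0 := by
  rw [weilQuadratic_eq_weilFinitePrimeQuadratic hg N hsupp, Complex.ofReal_im]

/-- **Reduction of finite-prime Weil positivity to its analytic form**:
`WeilPositivityOn ((log (N+1))/2) ↔ ∀ g ∈ C((log (N+1))/2), 0 ≤ E_N(g)`. [cite: Yoshida1992, Thm 1 shape (§6) with the p^m-terms, p^m ≤ N] -/
theorem weilPositivityOn_log_succ_half_iff (N : ℕ) :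
    WeilPositivityOn (Real.log ((N : ℝ) + 1) / 2) ↔
      ∀ g : ℝ → ℂ, IsWeilTest g →
        tsupport g ⊆ Icc (-(Real.log ((N : ℝ) + 1) / 2)) (Real.log ((N : ℝ) + 1) / 2) →
        0 ≤ weilFinitePrimeQuadratic N g := by
  unfold WeilPositivityOn
  refine forall₃_congr fun g hg hsupp ↦ ?_
  rw [weilQuadratic_re_eq_weilFinitePrimeQuadratic hg N hsupp]

/-! ## `N = 3`: the two-prime form `E₂₃` -/

/-- `Λ(n)/√n · 2cos(t log n)` summed over `n ≤ 3` is the two ripples of `w₂₃`: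
`w₃(t) = w₂₃(t)`. [folklore] -/
theorem weilFinitePrimeWeight_three (t : ℝ) : weilFinitePrimeWeight 3 t = weilTwoPrimeWeight t := by
  unfold weilFinitePrimeWeight weilPrimeRipple weilTwoPrimeWeight
  simp only [Finset.sum_range_succ, Finset.sum_range_zero, Nat.cast_zero, Nat.cast_one,
    ArithmeticFunction.map_zero, ArithmeticFunction.vonMangoldt_apply_one]
  rw [show ((2 : ℕ) : ℝ) = 2 by norm_num, show ((3 : ℕ) : ℝ) = 3 by norm_num,
    ArithmeticFunction.vonMangoldt_apply_prime Nat.prime_two,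
    ArithmeticFunction.vonMangoldt_apply_prime Nat.prime_three]
  push_cast
  rw [log_div_sqrt_eq two_pos]
  have h3 : Real.log 3 / Real.sqrt 3 * (2 * Real.cos (t * Real.log 3)) =
      2 * Real.log 3 / Real.sqrt 3 * Real.cos (t * Real.log 3) := by ring
  rw [h3]
  ring

/-- **`E₃ = E₂₃`** (for every `g`): the finite-prime form at `N = 3` is the two-prime form. [folklore] -/
theorem weilFinitePrimeQuadratic_three (g : ℝ → ℂ) : weilFinitePrimeQuadratic 3 g = weilTwoPrimeQuadratic g := by
  unfold weilFinitePrimeQuadratic weilTwoPrimeQuadratic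
  simp_rw [weilFinitePrimeWeight_three]

/-! ## `N = 4`: the `{2,3,4}`-form `E₂₃₄` on `C((log 5)/2)` -/

/-- The `{2,3,4}`-weight `w₂₃₄(t) = w₂₃(t) − log 2 · cos(t log 4)`: the prime power `4 = 2²` contributes the ripple
`(Λ(4)/√4)·2cos(t log 4) = log 2 · cos(t log 4)`. [cite: Yoshida1992, §2 eq. (2.1) with the p^m = 2, 3, 4 terms] -/
def weilThreePrimeWeight (t : ℝ) : ℝ :=
  weilTwoPrimeWeight t - Real.log 2 * Real.cos (t * Real.log 4)

/-- The `{2,3,4}` analytic form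
`E₂₃₄(g) = 2 Re(ĝ(0) conj ĝ(1)) − (log π) ‖g‖₂² + (1/2π) ∫ |ĝ(1/2+it)|² w₂₃₄(t) dt`. [cite: Yoshida1992, §2 eq. (2.1) with the p^m = 2, 3, 4 terms] -/
def weilThreePrimeQuadratic (g : ℝ → ℂ) : ℝ :=
  2 * (weilMellin g 0 * conj (weilMellin g 1)).re - Real.log π * weilNorm2Sq g +
    1 / (2 * π) * ∫ t : ℝ, ‖weilMellin g (1 / 2 + t * I)‖ ^ 2 * weilThreePrimeWeight t

/-- `Λ(4) = log 2`. [folklore] -/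
theorem vonMangoldt_four : (ArithmeticFunction.vonMangoldt 4 : ℝ) = Real.log 2 := by
  rw [show (4 : ℕ) = 2 ^ 2 by norm_num, ArithmeticFunction.vonMangoldt_apply_pow two_ne_zero,
    ArithmeticFunction.vonMangoldt_apply_prime Nat.prime_two]
  norm_num

/-- `w₄(t) = w₂₃₄(t)`. [folklore] -/
theorem weilFinitePrimeWeight_four (t : ℝ) : weilFinitePrimeWeight 4 t = weilThreePrimeWeight t := by
  have h3 := weilFinitePrimeWeight_three t
  unfold weilFinitePrimeWeight at h3 ⊢
  unfold weilThreePrimeWeight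
  rw [← h3]
  unfold weilPrimeRipple
  rw [Finset.sum_range_succ _ 4]
  have hsqrt4 : Real.sqrt 4 = 2 := by
    rw [show (4 : ℝ) = 2 ^ 2 by norm_num, Real.sqrt_sq (by norm_num : (0 : ℝ) ≤ 2)]
  rw [show ((4 : ℕ) : ℝ) = 4 by norm_num, vonMangoldt_four, hsqrt4]
  ring

/-- **`E₄ = E₂₃₄`** (for every `g`). [folklore] -/
theorem weilFinitePrimeQuadratic_four (g : ℝ → ℂ) : weilFinitePrimeQuadratic 4 g = weilThreePrimeQuadratic g := by
  unfold weilFinitePrimeQuadratic weilThreePrimeQuadratic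
  simp_rw [weilFinitePrimeWeight_four]

/-- The `{2,3,4}`-weight is measurable. [folklore] -/
theorem measurable_weilThreePrimeWeight : Measurable weilThreePrimeWeight :=
  measurable_weilTwoPrimeWeight.sub (by fun_prop)

/-- `t ↦ |ĝ(1/2+it)|² w₂₃₄(t)` is integrable. [folklore] -/
theorem integrable_norm_sq_weilMellin_mul_weilThreePrimeWeight (hg : IsWeilTest g) :
    Integrable fun t : ℝ ↦ ‖weilMellin g (1 / 2 + t * I)‖ ^ 2 * weilThreePrimeWeight t := by
  have h := integrable_norm_sq_weilMellin_mul_weilFinitePrimeWeight hg 4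
  simp_rw [weilFinitePrimeWeight_four] at h
  exact h

/-- **`Re Q(g) = E₂₃₄(g)` on `C((log 5)/2)`**: for `tsupport g ⊆ [-(log 5)/2, (log 5)/2]` exactly the prime powers
`2, 3, 4` are visible (`5` sits on the boundary). [cite: Yoshida1992, §2 eq. (2.1) with the p^m = 2, 3, 4 terms] -/
theorem weilQuadratic_re_eq_weilThreePrimeQuadratic (hg : IsWeilTest g)
    (hsupp : tsupport g ⊆ Icc (-(Real.log 5 / 2)) (Real.log 5 / 2)) :
    (weilQuadratic g).re = weilThreePrimeQuadratic g := by
  have h5 : Real.log ((4 : ℕ) + 1 : ℝ) = Real.log 5 := by norm_num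
  have hsupp' : tsupport g ⊆ Icc (-(Real.log (((4 : ℕ) : ℝ) + 1) / 2)) (Real.log (((4 : ℕ) : ℝ) + 1) / 2) := by
    rwa [h5]
  rw [weilQuadratic_re_eq_weilFinitePrimeQuadratic hg 4 hsupp', weilFinitePrimeQuadratic_four]

/-- `Q(g) = E₂₃₄(g)` as complex numbers on `C((log 5)/2)`. [cite: Yoshida1992, §2 eq. (2.1) with the p^m = 2, 3, 4 terms] -/
theorem weilQuadratic_eq_weilThreePrimeQuadratic (hg : IsWeilTest g)
    (hsupp : tsupport g ⊆ Icc (-(Real.log 5 / 2)) (Real.log 5 / 2)) :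
    weilQuadratic g = (weilThreePrimeQuadratic g : ℂ) := by
  have h5 : Real.log ((4 : ℕ) + 1 : ℝ) = Real.log 5 := by norm_num
  have hsupp' : tsupport g ⊆ Icc (-(Real.log (((4 : ℕ) : ℝ) + 1) / 2)) (Real.log (((4 : ℕ) : ℝ) + 1) / 2) := by
    rwa [h5]
  rw [weilQuadratic_eq_weilFinitePrimeQuadratic hg 4 hsupp', weilFinitePrimeQuadratic_four]

/-- The `{2,3,4}`-form extends the two-prime form: on `C(log 2)` they agree (the spikes `k(±log 4)` vanish there).
[folklore] -/
theorem weilThreePrimeQuadratic_eq_weilTwoPrimeQuadratic (hg : IsWeilTest g)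
    (hsupp : tsupport g ⊆ Icc (-Real.log 2) (Real.log 2)) :
    weilThreePrimeQuadratic g = weilTwoPrimeQuadratic g := by
  have h25 : Real.log 2 ≤ Real.log 5 / 2 := by
    have h45 : Real.log 4 ≤ Real.log 5 := Real.log_le_log (by norm_num) (by norm_num)
    rw [show (4 : ℝ) = 2 ^ 2 by norm_num, Real.log_pow] at h45
    push_cast at h45
    linarith
  have hsupp' : tsupport g ⊆ Icc (-(Real.log 5 / 2)) (Real.log 5 / 2) :=
    hsupp.trans (Icc_subset_Icc (by linarith) h25)
  rw [← weilQuadratic_re_eq_weilThreePrimeQuadratic hg hsupp', weilQuadratic_re_eq_weilTwoPrimeQuadratic hg hsupp]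

/-- **Reduction of `{2,3,4}` Weil positivity to its analytic form**:
`WeilPositivityOn ((log 5)/2) ↔ ∀ g ∈ C((log 5)/2), 0 ≤ E₂₃₄(g)`. [cite: Yoshida1992, Thm 1 shape (§6) with the p^m = 2, 3, 4 terms] -/
theorem weilPositivityOn_log_five_half_iff :
    WeilPositivityOn (Real.log 5 / 2) ↔
      ∀ g : ℝ → ℂ, IsWeilTest g → tsupport g ⊆ Icc (-(Real.log 5 / 2)) (Real.log 5 / 2) →
        0 ≤ weilThreePrimeQuadratic g := by
  unfold WeilPositivityOn
  refine forall₃_congr fun g hg hsupp ↦ ?_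
  rw [weilQuadratic_re_eq_weilThreePrimeQuadratic hg hsupp]

end Literature.NumberTheory.LFunctions
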